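import Summits.AtomisticToContinuum.BoseEinsteinCondensation.Theorems.BECConjugateDominationPositiveMinimiserTorusGS
import HarnessLib

/-!
# Route `BECConjugateDomination`, support item `PositiveMinimiser` — the Feynman–Kac ground state on
# the torus, II: Bose symmetry, normalisation, the energy identity and existence

Step of item stmt-AtomisticToContinuum-11787 (torus twin of the tree's Dirichlet
`GroundStateFeynmanKacWitnessSymm.lean` / `GroundStateFeynmanKac_holds`). For a measurable pair
potential with bounded periodisation `v^per ≤ C` and `L > 0`:

* `pep_comp_perm_ae_eq_cell` — the relabelled positive representative `e⁺ ∘ (· ∘ σ)` is again a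
  unit nonnegative eigenvector of `e^{-H}` for `μ₀ = ‖e^{-H}‖`, hence equals `e⁺` a.e. (simplicity);
  `tgs_comp_perm` — **Bose symmetry `φ₀ (X ∘ σ) = φ₀ X` at every point**;
* `lintegral_tgs_sq`, `integral_tgs_sq` — `∫_cell φ₀² = 1`;
* `pairing_le_rpow_cell` — the Rayleigh bound `⟨f, e^{-tH}f⟩_cell ≤ μ₀ᵗ ‖f‖²_cell` on periodic `C¹`
  functions (`inner_semigroup_le_rpow_mul`);
* `exists_torus_groundState` — **existence of the torus Feynman–Kac ground state**: a continuous,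
  strictly positive, periodic, Bose-symmetric, cell-normalised `Ψ₀` and `λ ≥ 0` with
  `e^{-tH}Ψ₀ = e^{-λt}Ψ₀` pointwise (`t > 0`) and `periodicGroundStateEnergy v N L = λ`
  (`periodicGroundStateEnergy_eq_ofReal_of_feynmanKac`).

[folklore] (Reed–Simon IV Thm XIII.44 and §XIII.12; Chung–Zhao Thms 3.17, 3.27, Prop 3.29.)
-/

noncomputable section

namespace Summit.AtomisticToContinuum.BoseEinsteinCondensation.Theorems.PositiveMinimiser

open MeasureTheory ProbabilityTheory Filter Set
open scoped ENNReal NNReal Topology InnerProductSpace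
open Literature.MathematicalPhysics.QuantumManyBody.BoseGas

variable {N : ℕ} {v : ℝ → ℝ≥0∞} {L : ℝ} {C : ℝ≥0}

section Symm

variable {e : Lp ℝ 2 (volume.restrict (cellN N L))} {φ : Config N → ℝ}

/-- **The relabelled positive part is again the eigenfunction, a.e. on the cell**:
`e⁺₀ ∘ (· ∘ σ) = e⁺₀` a.e. on `[0,L)^{3N}` (`e⁺₀ = max(e, 0)`), by simplicity of `μ₀`. [folklore] -/
theorem posRep_comp_perm_ae_eq_cell (hv : Measurable v) (hL : 0 < L) (hC : ∀ x, periodizedPotential v L x ≤ C)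
    (he1 : ‖e‖ = 1) (he0 : 0 ≤ e) (hTe : pfkL2 v L 1 e = ‖pfkL2 (N := N) v L 1‖ • e)
    (hsimple : ∀ f, pfkL2 v L 1 f = ‖pfkL2 (N := N) v L 1‖ • f → ∃ c : ℝ, f = c • e)
    (σ : Equiv.Perm (Fin N)) :
    ((fun Y => max ((e : Config N → ℝ) Y) 0) ∘ fun Y : Config N => Y ∘ σ)
      =ᵐ[volume.restrict (cellN N L)] fun Y => max ((e : Config N → ℝ) Y) 0 := by
  set μ₀ : ℝ := ‖pfkL2 (N := N) v L 1‖ with hμ₀def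
  obtain ⟨ep, hepdef⟩ : ∃ ep : Config N → ℝ, ep = fun Y => max ((e : Config N → ℝ) Y) 0 := ⟨_, rfl⟩
  obtain ⟨ρ, hρdef⟩ : ∃ ρ : Config N → Config N, ρ = fun Y => Y ∘ σ := ⟨_, rfl⟩
  rw [← hepdef, ← hρdef]
  have hp : MeasurePreserving ρ (volume.restrict (cellN N L)) (volume.restrict (cellN N L)) := by
    rw [hρdef]; exact measurePreserving_relabel_restrict_cellN (N := N) σ L
  have hmeas : Measurable ep := by rw [hepdef]; exact (measurable_coeFn_Lp_cellN e).max measurable_const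
  have hep0 : ∀ Y, 0 ≤ ep Y := fun Y => by rw [hepdef]; exact le_max_right _ _
  have hep_ae : ep =ᵐ[volume.restrict (cellN N L)] (e : Config N → ℝ) := by
    rw [hepdef]
    filter_upwards [(Lp.coeFn_nonneg e).2 he0] with Y hY
    exact max_eq_left hY
  -- `e^{-H}(ep ∘ cellProj) = μ₀ e` a.e. on the cell
  have hTep : pfkReal v L 1 (ep ∘ cellProj L) =ᵐ[volume.restrict (cellN N L)]
      fun Y => μ₀ * (e : Config N → ℝ) Y := by
    have h := pfkReal_pep_ae_eq_rpow hv hL hC he1 he0 hTe hsimple one_pos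
    rw [Real.rpow_one] at h
    rw [hepdef]
    exact h
  -- relabelling commutes with the periodic extension
  have hcomm : (ep ∘ ρ) ∘ cellProj L = (ep ∘ cellProj L) ∘ ρ := by
    funext Y
    simp only [Function.comp_apply, hρdef, cellProj_comp_perm]
  have hcov : ∀ Y, pfkReal v L 1 ((ep ∘ ρ) ∘ cellProj L) Y = pfkReal v L 1 (ep ∘ cellProj L) (ρ Y) := by
    intro Y
    rw [hcomm, hρdef]
    exact (pfkReal_comp_perm v L 1 (ep ∘ cellProj L) σ Y).symm
  -- the relabelled class
  have hmem : MemLp ep 2 (volume.restrict (cellN N L)) := (Lp.memLp e).ae_eq hep_ae.symm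
  have hmemσ : MemLp (ep ∘ ρ) 2 (volume.restrict (cellN N L)) := hmem.comp_measurePreserving hp
  obtain ⟨eσ, heσdef⟩ : ∃ x : Lp ℝ 2 (volume.restrict (cellN N L)), x = hmemσ.toLp _ := ⟨_, rfl⟩
  have heσ : (eσ : Config N → ℝ) =ᵐ[volume.restrict (cellN N L)] (ep ∘ ρ) := by
    rw [heσdef]; exact hmemσ.coeFn_toLp
  have hstep : (pfkReal v L 1 (ep ∘ cellProj L) ∘ ρ) =ᵐ[volume.restrict (cellN N L)]
      ((fun Y => μ₀ * (e : Config N → ℝ) Y) ∘ ρ) :=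
    hp.quasiMeasurePreserving.ae_eq_comp hTep
  have hep_aeσ : (ep ∘ ρ) =ᵐ[volume.restrict (cellN N L)] ((e : Config N → ℝ) ∘ ρ) :=
    hp.quasiMeasurePreserving.ae_eq_comp hep_ae
  -- `T_1 eσ = μ₀ eσ`
  have hTσ : pfkL2 v L 1 eσ = μ₀ • eσ := by
    refine Lp.ext ?_
    filter_upwards [pfkL2_coeFn hv hL one_pos eσ, Lp.coeFn_smul μ₀ eσ, hstep, heσ, hep_aeσ]
      with Y h1 h2 h3 h4 h5
    rw [h1, pfkReal_comp_cellProj_congr_ae v hL one_pos heσ Y, hcov Y, h2, Pi.smul_apply, smul_eq_mul,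
      h4, h5]
    exact h3
  obtain ⟨c, hc⟩ := hsimple eσ hTσ
  -- `‖eσ‖ = 1`, hence `|c| = 1`
  have hnorm : ‖eσ‖ = 1 := by
    rw [heσdef, Lp.norm_toLp, eLpNorm_comp_measurePreserving hmem.aestronglyMeasurable hp,
      eLpNorm_congr_ae hep_ae, ← Lp.norm_def, he1]
  have hcabs : |c| = 1 := by
    have := congrArg norm hc
    rw [hnorm, norm_smul, he1, mul_one, Real.norm_eq_abs] at this
    exact this.symm
  have hcoe : (eσ : Config N → ℝ) =ᵐ[volume.restrict (cellN N L)] fun Y => c * (e : Config N → ℝ) Y := by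
    have h1 : (eσ : Config N → ℝ) =ᵐ[volume.restrict (cellN N L)]
        ((c • e : Lp ℝ 2 (volume.restrict (cellN N L))) : Config N → ℝ) := by
      rw [← hc]
    filter_upwards [h1, Lp.coeFn_smul c e] with Y hY1 hY2
    rw [hY1, hY2, Pi.smul_apply, smul_eq_mul]
  -- `c = 1`: both classes are nonnegative and nonzero
  have hc1 : c = 1 := by
    rcases (abs_eq zero_le_one).1 hcabs with h | h
    · exact h
    · exfalso
      have hzero : e = 0 := by
        rw [Lp.eq_zero_iff_ae_eq_zero]
        filter_upwards [heσ, (Lp.coeFn_nonneg e).2 he0, hcoe] with Y h1 h2 h3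
        have h4 : 0 ≤ (eσ : Config N → ℝ) Y := by rw [h1]; exact hep0 _
        rw [h3, h] at h4
        have h2' : 0 ≤ (e : Config N → ℝ) Y := by simpa using h2
        rw [Pi.zero_apply]
        linarith
      rw [hzero, norm_zero] at he1
      exact zero_ne_one he1
  rw [hc1] at hcoe
  filter_upwards [heσ, hcoe, hep_ae] with Y h1 h2 h3
  rw [← h1, h2, one_mul, ← h3]

/-- **Bose symmetry of the torus ground-state function**: `φ₀ (X ∘ σ) = φ₀ X` for every permutation
`σ` of the particles and EVERY `X`. [folklore] -/
theorem tgs_comp_perm (hv : Measurable v) (hL : 0 < L) (hC : ∀ x, periodizedPotential v L x ≤ C)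
    (he1 : ‖e‖ = 1) (he0 : 0 ≤ e) (hTe : pfkL2 v L 1 e = ‖pfkL2 (N := N) v L 1‖ • e)
    (hsimple : ∀ f, pfkL2 v L 1 f = ‖pfkL2 (N := N) v L 1‖ • f → ∃ c : ℝ, f = c • e)
    (hφ : φ = fun X => ‖pfkL2 (N := N) v L 1‖⁻¹ *
      pfkReal v L 1 (fun Y => max ((e : Config N → ℝ) (cellProj L Y)) 0) X)
    (σ : Equiv.Perm (Fin N)) (X : Config N) : φ (X ∘ σ) = φ X := by
  -- the relabelled periodic representative equals it a.e. on the whole space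
  have hae : (fun Y : Config N => max ((e : Config N → ℝ) (cellProj L (Y ∘ σ))) 0) =ᵐ[(volume : Measure (Config N))]
      fun Y => max ((e : Config N → ℝ) (cellProj L Y)) 0 := by
    have h := ae_comp_cellProj hL (posRep_comp_perm_ae_eq_cell hv hL hC he1 he0 hTe hsimple σ)
    refine h.mono fun Y hY => ?_
    simp only [Function.comp_apply] at hY
    show max ((e : Config N → ℝ) (cellProj L (Y ∘ σ))) 0 = max ((e : Config N → ℝ) (cellProj L Y)) 0
    rw [cellProj_comp_perm]
    exact hY
  rw [hφ]
  simp only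
  rw [pfkReal_comp_perm v L 1 _ σ X]
  exact congrArg _ (pfkReal_congr_ae v L one_pos hae X)

end Symm

/-! ### Normalisation -/

section Norm

variable {e : Lp ℝ 2 (volume.restrict (cellN N L))} {φ : Config N → ℝ}

/-- **`∫_cell φ₀² = 1`** in `[0, ∞]` (since `φ₀ = e` a.e. on the cell and `‖e‖ = 1`). [folklore] -/
theorem lintegral_tgs_sq (he1 : ‖e‖ = 1) (hφe : φ =ᵐ[volume.restrict (cellN N L)] (e : Config N → ℝ))
    (hφnn : ∀ X, 0 ≤ φ X) : ∫⁻ X in cellN N L, ENNReal.ofReal (φ X) ^ 2 = 1 := by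
  have h2 : ∫⁻ X in cellN N L, ENNReal.ofReal (φ X) ^ 2 = ∫⁻ X in cellN N L, ‖(e : Config N → ℝ) X‖ₑ ^ (2 : ℝ) := by
    refine lintegral_congr_ae ?_
    filter_upwards [hφe] with X hX
    have h0 : 0 ≤ (e : Config N → ℝ) X := hX ▸ hφnn X
    rw [ENNReal.rpow_two, hX, Real.enorm_of_nonneg h0]
  rw [h2]
  have h3 := ofReal_norm_Lp_cellN e
  rw [he1, ENNReal.ofReal_one] at h3
  have h4 : (∫⁻ X in cellN N L, ‖(e : Config N → ℝ) X‖ₑ ^ (2 : ℝ)) =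
      ((∫⁻ X in cellN N L, ‖(e : Config N → ℝ) X‖ₑ ^ (2 : ℝ)) ^ (1 / 2 : ℝ)) ^ (2 : ℝ) := by
    rw [← ENNReal.rpow_mul]; norm_num
  rw [h4, ← h3, ENNReal.one_rpow]

/-- **`∫_cell φ₀² = 1`** as a Bochner integral, for continuous periodic `φ₀` (`L > 0`). [folklore] -/
theorem integral_tgs_sq (hL : 0 < L) (hcont : Continuous φ)
    (hper : ∀ (X : Config N) (i : Fin N) (k : Fin 3), φ (X + Pi.single i (EuclideanSpace.single k L)) = φ X)
    (hφnn : ∀ X, 0 ≤ φ X) (h1 : ∫⁻ X in cellN N L, ENNReal.ofReal (φ X) ^ 2 = 1) :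
    ∫ X in cellN N L, φ X ^ 2 = 1 := by
  obtain ⟨M, -, hM⟩ := exists_bound_of_continuous_periodic hL hcont hper
  have hsq : Integrable (fun X => φ X ^ 2) (volume.restrict (cellN N L)) :=
    (memLp_two_cellN_of_bound L hcont.measurable hM).integrable_sq
  rw [integral_eq_lintegral_of_nonneg_ae (Eventually.of_forall fun X => sq_nonneg _)
    hsq.aestronglyMeasurable]
  have : (fun X => ENNReal.ofReal (φ X ^ 2)) = fun X => ENNReal.ofReal (φ X) ^ 2 := by
    funext X; rw [ENNReal.ofReal_pow (hφnn X)]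
  rw [this, h1, ENNReal.toReal_one]

end Norm

/-! ### The Rayleigh bound on periodic `C¹` functions -/

/-- **`⟨f, e^{-tH} f⟩_cell ≤ ‖e^{-H}‖ᵗ ‖f‖²_cell` for continuous periodic real `f`** (`t > 0`): the
abstract Rayleigh bound `inner_semigroup_le_rpow_mul` for the class of `f` in `L²(cell)`.
[folklore] -/
theorem pairing_le_rpow_cell (hv : Measurable v) (hL : 0 < L) (hC : ∀ x, periodizedPotential v L x ≤ C)
    {f : Config N → ℝ} (hf : Continuous f)
    (hper : ∀ (X : Config N) (i : Fin N) (k : Fin 3), f (X + Pi.single i (EuclideanSpace.single k L)) = f X)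
    {t : ℝ} (ht : 0 < t) :
    ∫ X in cellN N L, f X * pfkReal v L t f X ≤ ‖pfkL2 (N := N) v L 1‖ ^ t * ∫ X in cellN N L, f X ^ 2 := by
  obtain ⟨M, -, hM⟩ := exists_bound_of_continuous_periodic hL hf hper
  have hf2 : MemLp f 2 (volume.restrict (cellN N L)) := memLp_two_cellN_of_bound L hf.measurable hM
  obtain ⟨F, hF⟩ : ∃ F : Lp ℝ 2 (volume.restrict (cellN N L)), F = hf2.toLp f := ⟨_, rfl⟩
  have hFf : (F : Config N → ℝ) =ᵐ[volume.restrict (cellN N L)] f := by rw [hF]; exact hf2.coeFn_toLp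
  have hadd : ∀ s t : ℝ, 0 < s → 0 < t →
      pfkL2 (N := N) v L (s + t) = (pfkL2 v L s).comp (pfkL2 v L t) :=
    fun s t hs ht => pfkL2_add_time hv hL hs ht
  have hcontr : ∀ t : ℝ, 0 < t → ‖pfkL2 (N := N) v L t‖ ≤ 1 := fun t _ => norm_pfkL2_le_one v L t
  have hsym : ∀ t : ℝ, 0 < t → ∀ x y : Lp ℝ 2 (volume.restrict (cellN N L)),
      ⟪pfkL2 v L t x, y⟫_ℝ = ⟪x, pfkL2 v L t y⟫_ℝ := fun t ht x y => inner_pfkL2_comm hv hL ht x y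
  have hμ₀ : 0 < ‖pfkL2 (N := N) v L 1‖ :=
    norm_pos_iff.2 (pfkL2_perronFrobenius (N := N) hv hL hC one_pos).1
  have h1 := inner_semigroup_le_rpow_mul (S := fun t => pfkL2 (N := N) v L t) hadd hcontr hsym hμ₀ F ht
  have h2 : ∫ X in cellN N L, f X * pfkReal v L t f X = ⟪F, pfkL2 v L t F⟫_ℝ := by
    rw [inner_Lp_eq_integral]
    have h3 : ((pfkL2 v L t F : Lp ℝ 2 (volume.restrict (cellN N L))) : Config N → ℝ)
        =ᵐ[volume.restrict (cellN N L)] pfkReal v L t (⇑F ∘ cellProj L) := pfkL2_coeFn hv hL ht F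
    have h4 : ∀ X, pfkReal v L t (⇑F ∘ cellProj L) X = pfkReal v L t f X := fun X => by
      rw [pfkReal_comp_cellProj_congr_ae v hL ht hFf X, comp_cellProj_eq_self hper]
    refine integral_congr_ae ?_
    filter_upwards [hFf, h3] with X hX h3X
    rw [hX, h3X, h4]
  have h3 : ∫ X in cellN N L, f X ^ 2 = ‖F‖ ^ 2 := by
    rw [← real_inner_self_eq_norm_sq, inner_Lp_eq_integral]
    refine integral_congr_ae ?_
    filter_upwards [hFf] with X hX
    rw [hX, sq]
  rw [h2, h3]
  exact h1

/-! ### Existence of the torus Feynman–Kac ground state -/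

/-- **The Feynman–Kac ground state of the periodic `N`-body Hamiltonian exists** (measurable pair
potential with bounded periodisation `v^per ≤ C`, `L > 0`): there are a continuous, strictly
positive, `Lℤ³`-periodic, Bose-symmetric, cell-normalised `Ψ₀ : (ℝ³)^N → ℝ` and `λ ≥ 0` with the
pointwise eigen-relation `(e^{-tH}Ψ₀)(X) = e^{-λt}Ψ₀(X)` for all `t > 0` and all `X`, and
`periodicGroundStateEnergy v N L = λ` (the variational infimum over the symmetric periodic `C¹`
core IS the Perron–Frobenius eigenvalue). Reed–Simon IV Thm XIII.44; Chung–Zhao (1995) Thms 3.17,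
3.27, Prop 3.29. [folklore] -/
theorem exists_torus_groundState (hv : Measurable v) (hL : 0 < L)
    (hC : ∀ x, periodizedPotential v L x ≤ C) :
    ∃ (Ψ₀ : Config N → ℝ) (lam : ℝ), 0 ≤ lam ∧ Continuous Ψ₀ ∧ (∀ X, 0 < Ψ₀ X) ∧
      (∀ (X : Config N) (i : Fin N) (k : Fin 3), Ψ₀ (X + Pi.single i (EuclideanSpace.single k L)) = Ψ₀ X) ∧
      (∀ (σ : Equiv.Perm (Fin N)) (X : Config N), Ψ₀ (X ∘ σ) = Ψ₀ X) ∧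
      (∫⁻ X in cellN N L, ENNReal.ofReal (Ψ₀ X) ^ 2 = 1) ∧ (∫ X in cellN N L, Ψ₀ X ^ 2 = 1) ∧
      (∀ t : ℝ, 0 < t → ∀ X, pfkReal v L t Ψ₀ X = Real.exp (-(lam * t)) * Ψ₀ X) ∧
      periodicGroundStateEnergy v N L = ENNReal.ofReal lam := by
  -- Perron–Frobenius data at time one
  obtain ⟨hT0, e, he1, he0, hTe, -, hsimple⟩ := pfkL2_perronFrobenius (N := N) hv hL hC one_pos
  set μ₀ : ℝ := ‖pfkL2 (N := N) v L 1‖ with hμ₀def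
  have hμ₀ : 0 < μ₀ := norm_pos_iff.2 hT0
  -- the witness
  obtain ⟨φ, hφ⟩ : ∃ φ : Config N → ℝ,
      φ = fun X => μ₀⁻¹ * pfkReal v L 1 (fun Y => max ((e : Config N → ℝ) (cellProj L Y)) 0) X := ⟨_, rfl⟩
  have hφnn : ∀ X, 0 ≤ φ X := tgs_nonneg hμ₀.le hφ
  have hφper := tgs_periodic (v := v) (e := e) hL.ne' hφ
  have hφcont : Continuous φ := continuous_tgs hv hL hC he0 hφ
  have hφe : φ =ᵐ[volume.restrict (cellN N L)] (e : Config N → ℝ) := tgs_ae_eq_cell hv hL hC he1 he0 hTe hsimple hφ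
  have hφeig : ∀ T : ℝ, 0 < T → ∀ X, pfkReal v L T φ X = μ₀ ^ T * φ X := fun T hT X =>
    pfkReal_tgs hv hL hC he1 he0 hTe hsimple hφ hT X
  have hφpos : ∀ X, 0 < φ X := tgs_pos hv hL hC he1 he0 hφ
  have hφsymm : ∀ (σ : Equiv.Perm (Fin N)) (X : Config N), φ (X ∘ σ) = φ X :=
    tgs_comp_perm hv hL hC he1 he0 hTe hsimple hφ
  have hnormL : ∫⁻ X in cellN N L, ENNReal.ofReal (φ X) ^ 2 = 1 := lintegral_tgs_sq he1 hφe hφnn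
  have hnormR : ∫ X in cellN N L, φ X ^ 2 = 1 := integral_tgs_sq hL hφcont hφper hφnn hnormL
  -- the eigenvalue `λ = -log μ₀`
  obtain ⟨lam, hlam⟩ : ∃ lam : ℝ, lam = -Real.log μ₀ := ⟨_, rfl⟩
  have hexp : ∀ t : ℝ, Real.exp (-(lam * t)) = μ₀ ^ t := fun t => by
    rw [Real.rpow_def_of_pos hμ₀, hlam]; congr 1; ring
  have htop : ∀ f : Config N → ℝ, ContDiff ℝ 1 f →
      (∀ (X : Config N) (i : Fin N) (k : Fin 3), f (X + Pi.single i (EuclideanSpace.single k L)) = f X) →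
      ∀ t : ℝ, 0 < t →
        ∫ X in cellN N L, f X * pfkReal v L t f X ≤ Real.exp (-(lam * t)) * ∫ X in cellN N L, f X ^ 2 := by
    intro f hf hfper t ht
    rw [hexp]
    exact pairing_le_rpow_cell hv hL hC hf.continuous hfper ht
  have heig' : ∀ t : ℝ, 0 < t → Real.exp (-(lam * t)) ≤ ∫ X in cellN N L, φ X * pfkReal v L t φ X := by
    intro t ht
    have : (fun X => φ X * pfkReal v L t φ X) = fun X => μ₀ ^ t * φ X ^ 2 := by
      funext X; rw [hφeig t ht X]; ring
    rw [hexp, this, integral_const_mul, hnormR, mul_one]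
  obtain ⟨hE, hlam0⟩ :=
    periodicGroundStateEnergy_eq_ofReal_of_feynmanKac hL hv hC htop hφcont hφper hφnn hφsymm hnormR heig'
  refine ⟨φ, lam, hlam0, hφcont, hφpos, hφper, hφsymm, hnormL, hnormR, fun t ht X => ?_, hE⟩
  rw [hφeig t ht X, hexp]

end Summit.AtomisticToContinuum.BoseEinsteinCondensation.Theorems.PositiveMinimiser

end
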